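import Literature.Computability.QuantumComplexity.ForrelationSignTransport
import HarnessLib

/-!
# M-subspace duality for exactly forrelated pairs

Topic `Literature/Computability/QuantumComplexity` (family `quantum-advantage`; refuter seat
`refuter-cdisprove-stmt-QuantumAdvantage-13932-0`, 2026-08-16; crux `SignedExactCubicForrelationNotPrBPP`
of route `QuantumAdvantage/CubicForrelation`, item stmt-QuantumAdvantage-13932). Theorems only; continues
`ForrelationSignTransport.lean` (sign transport (★)) in namespace `DerivativeWalsh`.

**Main result** (`dual_affine_on_perp_cosets`). Let `V ≤ 𝔽₂ⁿ` be a subspace (a finset of bit vectors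
containing `0`, closed under `⊕`) with `|V|² = 2ⁿ`, on whose cosets the Boolean function `b` is AFFINE
(all second differences of `b` along `V` vanish — an *M-subspace*; by Dillon's criterion a bent function has
one iff it lies in the completed Maiorana–McFarland class [Carlet2020, Prop. 54]). If `Φ(a,b) = ±1` then
`a` is affine on every coset `x₀ + V^⊥`: some `r` has `(-1)^{a(x₀ ⊕ x)} (-1)^{x·r} = (-1)^{a(x₀)}` for all
`x ∈ V^⊥`. For Maiorana–McFarland templates `b = y'·π(y'') ⊕ h(y'')` this is McFarland's dual formula
`b̃ = x''·π⁻¹(x') ⊕ h(π⁻¹(x'))` [Carlet2020, Prop. 77]; here it is proved for ALL exactly forrelated pairs, by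
sign transport applied to the re-randomised real pair `x ↦ (-1)^{a(x₀ ⊕ x)}`, `y ↦ (-1)^{b(y)} (-1)^{x₀·y}`.

Consequence (prose): an M-subspace `V` of `b` — however found — yields the bi-affine (hence bi-isotropic)
pair `(V, V^⊥)`, so the SIGN of `Φ` on an exact cubic pair is read off by (★) from two sums of affine
`±1`-functions; this certifies the sign step of every M-subspace-recovery attack on the signed exact slice.

## Contents (all proved)
* `sum_char_subspace` (a `±1` multiplicative character of a subspace sums to `|V|` or `0`),
  `card_mul_card_perp` (`|U|·|U^⊥| = 2ⁿ`), `bxor_mem_perp`, `subset_perp_perp`, `perp_perp_eq_of_sq`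
  (`|V|² = 2ⁿ ⇒ V^⊥⊥ = V`, `|V^⊥| = |V|`);
* `coset_sum_of_affine_on_cosets` (twisted coset sums of an M-subspace are `0` or `±|V|`),
  `all_eq_of_sum_eq_card`, `dual_affine_on_perp_cosets`.
Not here: `Submodule (ZMod 2)` language; the converse direction; anything computational.

## References
* [Carlet2020] C. Carlet, Boolean Functions for Cryptography and Coding Theory, CUP 2021: Prop. 54
  (completed MM class ⇔ an `n/2`-dimensional subspace with vanishing second-order derivatives), Prop. 77
  (dual of a Maiorana–McFarland bent function).
* [AaronsonAmbainis2018] S. Aaronson, A. Ambainis, Forrelation, SIAM J. Comput. 47 (2018), §1.1.1.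
* [ODonnell2014] R. O'Donnell, Analysis of Boolean Functions (2014), §1.4, §3.3.
-/

noncomputable section

namespace Literature.Computability.QuantumComplexity

namespace DerivativeWalsh

open Finset
open Literature.Computability.QuantumComplexity.BuzetChailloux
open Literature.Computability.QuantumComplexity.Simon (twist_mul_self twist_sq twist_eq_one_or sum_twist)

variable {n : ℕ}

/-! ### Characters and orthogonals of subspaces -/

/-- A `±1`-valued multiplicative character of a finset `V` closed under `⊕` sums to `|V|` or to `0`.
[cite: ODonnell2014, §3.3] -/
theorem sum_char_subspace {V : Finset (Fin n → Bool)} (hadd : ∀ x ∈ V, ∀ y ∈ V, bxor x y ∈ V)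
    (χ : (Fin n → Bool) → ℝ) (hsq : ∀ v ∈ V, χ v = 1 ∨ χ v = -1)
    (hmul : ∀ u ∈ V, ∀ v ∈ V, χ (bxor u v) = χ u * χ v) :
    ∑ v ∈ V, χ v = V.card ∨ ∑ v ∈ V, χ v = 0 := by
  by_cases hall : ∀ v ∈ V, χ v = 1
  · left
    rw [sum_congr rfl hall, sum_const, nsmul_eq_mul, mul_one]
  · right
    push Not at hall
    obtain ⟨u₀, hu₀, hne⟩ := hall
    have hneg : χ u₀ = -1 := (hsq u₀ hu₀).resolve_left hne
    have key : ∑ v ∈ V, χ (bxor u₀ v) = ∑ v ∈ V, χ v :=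
      Finset.sum_nbij' (fun v => bxor u₀ v) (fun v => bxor u₀ v)
        (fun a ha => hadd u₀ hu₀ a ha) (fun a ha => hadd u₀ hu₀ a ha)
        (fun a _ => bxor_bxor_cancel_left u₀ a) (fun a _ => bxor_bxor_cancel_left u₀ a)
        (fun a _ => rfl)
    have h2 : ∑ v ∈ V, χ (bxor u₀ v) = χ u₀ * ∑ v ∈ V, χ v := by
      rw [mul_sum]
      exact sum_congr rfl fun v hv => hmul u₀ hu₀ v hv
    have h3 := key.symm.trans h2
    rw [hneg] at h3
    linarith

/-- `|U| · |U^⊥| = 2ⁿ` for a finset `U ∋ 0` closed under `⊕` (count `∑_x ∑_{u ∈ U} (-1)^{u·x}` two ways).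
[cite: ODonnell2014, §3.3] -/
theorem card_mul_card_perp {U : Finset (Fin n → Bool)} (h0 : zeroVec ∈ U)
    (hadd : ∀ x ∈ U, ∀ y ∈ U, bxor x y ∈ U) :
    (U.card : ℝ) * (univ.filter fun y => ∀ x ∈ U, twist x y = 1).card = (2 : ℝ) ^ n := by
  have h1 : ∑ x : Fin n → Bool, ∑ u ∈ U, twist u x =
      (U.card : ℝ) * (univ.filter fun y => ∀ x ∈ U, twist x y = 1).card := by
    simp_rw [sum_twist_subspace hadd]
    rw [← sum_filter, sum_const, nsmul_eq_mul, mul_comm]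
  have h2 : ∑ x : Fin n → Bool, ∑ u ∈ U, twist u x = (2 : ℝ) ^ n := by
    rw [sum_comm]
    have : ∀ u ∈ U, ∑ x : Fin n → Bool, twist u x = if u = zeroVec then (2 : ℝ) ^ n else 0 :=
      fun u _ => sum_twist u
    rw [sum_congr rfl this, sum_ite_eq' U zeroVec, if_pos h0]
  rw [← h1, h2]

/-- `U^⊥` contains `0` and is closed under `⊕`. [folklore] -/
theorem bxor_mem_perp (U : Finset (Fin n → Bool)) :
    zeroVec ∈ (univ.filter fun y => ∀ x ∈ U, twist x y = 1) ∧
    ∀ y ∈ (univ.filter fun y => ∀ x ∈ U, twist x y = 1),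
      ∀ y' ∈ (univ.filter fun y => ∀ x ∈ U, twist x y = 1),
        bxor y y' ∈ (univ.filter fun y => ∀ x ∈ U, twist x y = 1) := by
  refine ⟨mem_filter.2 ⟨mem_univ _, fun x _ => twist_zeroVec_right x⟩, fun y hy y' hy' => ?_⟩
  refine mem_filter.2 ⟨mem_univ _, fun u hu => ?_⟩
  rw [twist_bxor_right, (mem_filter.1 hy).2 u hu, (mem_filter.1 hy').2 u hu, one_mul]

/-- `V ⊆ V^⊥⊥`. [folklore] -/
theorem subset_perp_perp (V : Finset (Fin n → Bool)) :
    V ⊆ univ.filter (fun z => ∀ y ∈ (univ.filter fun y => ∀ x ∈ V, twist x y = 1), twist y z = 1) := by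
  intro v hv
  refine mem_filter.2 ⟨mem_univ _, fun y hy => ?_⟩
  rw [twist_comm]
  exact (mem_filter.1 hy).2 v hv

/-- For a half-dimensional subspace (`|V|² = 2ⁿ`): `V^⊥⊥ = V` and `|V^⊥| = |V|`. [folklore] -/
theorem perp_perp_eq_of_sq {V : Finset (Fin n → Bool)} (h0 : zeroVec ∈ V)
    (hadd : ∀ x ∈ V, ∀ y ∈ V, bxor x y ∈ V) (hcard : (V.card : ℝ) ^ 2 = (2 : ℝ) ^ n) :
    univ.filter (fun z => ∀ y ∈ (univ.filter fun y => ∀ x ∈ V, twist x y = 1), twist y z = 1) = V ∧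
    ((univ.filter fun y => ∀ x ∈ V, twist x y = 1).card : ℝ) = V.card := by
  have hVpos : (0 : ℝ) < V.card := by exact_mod_cast card_pos.2 ⟨_, h0⟩
  have hp : ((univ.filter fun y => ∀ x ∈ V, twist x y = 1).card : ℝ) = V.card := by
    have := card_mul_card_perp h0 hadd
    rw [← hcard, sq] at this
    exact mul_left_cancel₀ hVpos.ne' this
  obtain ⟨hp0, hpadd⟩ := bxor_mem_perp V
  have hpp : ((univ.filter (fun z => ∀ y ∈ (univ.filter fun y => ∀ x ∈ V, twist x y = 1),
      twist y z = 1)).card : ℝ) = V.card := by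
    have := card_mul_card_perp hp0 hpadd
    rw [hp, ← hcard, sq] at this
    exact mul_left_cancel₀ hVpos.ne' this
  refine ⟨(eq_of_subset_of_card_le (subset_perp_perp V) ?_).symm, hp⟩
  exact_mod_cast hpp.le

/-! ### Coset sums of an M-subspace -/

/-- If `b` is affine on every coset of `V` (all second differences along `V` vanish: an **M-subspace**)
then every twisted coset sum `∑_{y ∈ r + V} (-1)^{b(y)} (-1)^{x₀·y}` is `|V|`, `-|V|` or `0`.
[cite: Carlet2020, Prop. 54] -/
theorem coset_sum_of_affine_on_cosets {V : Finset (Fin n → Bool)}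
    (hadd : ∀ x ∈ V, ∀ y ∈ V, bxor x y ∈ V) (b : (Fin n → Bool) → Bool)
    (hM : ∀ u ∈ V, ∀ v ∈ V, ∀ y, (b y ^^ b (bxor y u) ^^ b (bxor y v) ^^ b (bxor y (bxor u v))) = false)
    (r x₀ : Fin n → Bool) :
    let s := ∑ y ∈ univ.filter (fun y => bxor r y ∈ V), signOf (b y) * twist x₀ y
    s = V.card ∨ s = -V.card ∨ s = 0 := by
  intro s
  have hre : s = ∑ v ∈ V, signOf (b (bxor r v)) * twist x₀ (bxor r v) := by
    refine Finset.sum_nbij' (fun y => bxor r y) (fun v => bxor r v) ?_ ?_ ?_ ?_ ?_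
    · intro y hy; exact (mem_filter.1 hy).2
    · intro v hv; exact mem_filter.2 ⟨mem_univ _, by rwa [bxor_bxor_cancel_left]⟩
    · intro y _; exact bxor_bxor_cancel_left r y
    · intro v _; exact bxor_bxor_cancel_left r v
    · intro y _; rw [bxor_bxor_cancel_left]
  set χ : (Fin n → Bool) → ℝ := fun v => signOf (b (bxor r v)) * signOf (b r) * twist x₀ v with hχ
  have hterm : ∀ v ∈ V, signOf (b (bxor r v)) * twist x₀ (bxor r v) =
      signOf (b r) * twist x₀ r * χ v := by
    intro v _
    rw [hχ, twist_bxor_right]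
    have := signOf_sq (b r)
    simp only
    linear_combination (-(signOf (b (bxor r v)) * twist x₀ r * twist x₀ v)) * this
  have hsq : ∀ v ∈ V, χ v = 1 ∨ χ v = -1 := by
    intro v _
    have h1 : χ v ^ 2 = 1 := by
      rw [hχ]; simp only
      rw [mul_pow, mul_pow, signOf_sq, signOf_sq, twist_sq]; norm_num
    have h1' : χ v * χ v = 1 := by rw [← sq]; exact h1
    exact mul_self_eq_one_iff.1 h1'
  have hmul : ∀ u ∈ V, ∀ v ∈ V, χ (bxor u v) = χ u * χ v := by
    intro u hu v hv
    have h4 := hM u hu v hv r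
    rw [hχ]; simp only
    rw [twist_bxor_right]
    rcases Bool.eq_false_or_eq_true (b r) with e1 | e1 <;>
      rcases Bool.eq_false_or_eq_true (b (bxor r u)) with e2 | e2 <;>
        rcases Bool.eq_false_or_eq_true (b (bxor r v)) with e3 | e3 <;>
          rcases Bool.eq_false_or_eq_true (b (bxor r (bxor u v))) with e4 | e4 <;>
            simp only [e1, e2, e3, e4] at h4 ⊢ <;> simp [signOf] at h4 ⊢
  have hsum : ∑ v ∈ V, signOf (b (bxor r v)) * twist x₀ (bxor r v) =
      signOf (b r) * twist x₀ r * ∑ v ∈ V, χ v := by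
    rw [mul_sum]; exact sum_congr rfl hterm
  rw [hre, hsum]
  have hc : signOf (b r) * twist x₀ r = 1 ∨ signOf (b r) * twist x₀ r = -1 := by
    rcases twist_eq_one_or x₀ r with h | h <;>
      rcases Bool.eq_false_or_eq_true (b r) with h' | h' <;> simp [signOf, h, h']
  rcases sum_char_subspace hadd χ hsq hmul with h | h <;> rcases hc with h' | h' <;> rw [h, h'] <;>
    norm_num

/-- A sum of `±1` terms equal to `± card` forces every term to equal that sign. [folklore] -/
theorem all_eq_of_sum_eq_card {ι : Type*} [DecidableEq ι] (s : Finset ι) (f : ι → ℝ)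
    (hf : ∀ i ∈ s, f i = 1 ∨ f i = -1) (c : ℝ) (hc : c = 1 ∨ c = -1)
    (hsum : ∑ i ∈ s, f i = c * s.card) : ∀ i ∈ s, f i = c := by
  intro i hi
  by_contra hne
  have hfi : f i = -c := by
    rcases hf i hi with h | h <;> rcases hc with h' | h' <;> simp_all
  have key : ∑ j ∈ s, c * f j ≤ (s.card : ℝ) - 2 := by
    have hle : ∀ j ∈ s, c * f j ≤ 1 := by
      intro j hj
      rcases hf j hj with h | h <;> rcases hc with h' | h' <;> rw [h, h'] <;> norm_num
    have hsplit := Finset.add_sum_erase s (fun j => c * f j) hi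
    have hrest : ∑ j ∈ s.erase i, c * f j ≤ ((s.erase i).card : ℝ) := by
      have h' : ∑ j ∈ s.erase i, c * f j ≤ ∑ j ∈ s.erase i, (1 : ℝ) :=
        Finset.sum_le_sum fun j hj => hle j (Finset.mem_of_mem_erase hj)
      rwa [sum_const, nsmul_eq_mul, mul_one] at h'
    rw [Finset.card_erase_of_mem hi] at hrest
    have hci : c * f i = -1 := by
      rw [hfi]; rcases hc with h' | h' <;> rw [h'] <;> norm_num
    have hcard1 : (1 : ℕ) ≤ s.card := card_pos.2 ⟨i, hi⟩
    rw [← hsplit, hci]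
    push_cast [Nat.cast_sub hcard1] at hrest ⊢
    linarith
  have hsum' : ∑ j ∈ s, c * f j = s.card := by
    rw [← mul_sum, hsum, ← mul_assoc]
    rcases hc with h' | h' <;> rw [h'] <;> norm_num
  linarith

/-! ### The duality -/

/-- **M-subspace duality for exact pairs.** If `b` is affine on the cosets of a subspace `V` (`0 ∈ V`,
closed under `⊕`, `|V|² = 2ⁿ`, all second differences along `V` vanish) and `Φ(a,b) = ±1`, then `a` is
affine on every coset `x₀ + V^⊥`: some `r` gives `(-1)^{a(x₀ ⊕ x)} (-1)^{x·r} = (-1)^{a(x₀)}` for all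
`x ∈ V^⊥`. (McFarland's dual formula, for all exactly forrelated pairs.) [cite: Carlet2020, Prop. 77] -/
theorem dual_affine_on_perp_cosets {a b : (Fin n → Bool) → Bool}
    (hΦ : forrelation a b = 1 ∨ forrelation a b = -1) {V : Finset (Fin n → Bool)} (h0 : zeroVec ∈ V)
    (hadd : ∀ x ∈ V, ∀ y ∈ V, bxor x y ∈ V) (hcard : (V.card : ℝ) ^ 2 = (2 : ℝ) ^ n)
    (hM : ∀ u ∈ V, ∀ v ∈ V, ∀ y, (b y ^^ b (bxor y u) ^^ b (bxor y v) ^^ b (bxor y (bxor u v))) = false)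
    (x₀ : Fin n → Bool) :
    ∃ r : Fin n → Bool, ∀ x ∈ (univ.filter fun y => ∀ v ∈ V, twist v y = 1),
      signOf (a (bxor x₀ x)) * twist x r = signOf (a x₀) := by
  set f : (Fin n → Bool) → ℝ := fun x => signOf (a (bxor x₀ x)) with hf
  set g : (Fin n → Bool) → ℝ := fun y => signOf (b y) * twist x₀ y with hg
  have hf1 : ∀ x, f x ^ 2 = 1 := fun x => signOf_sq _
  have hg1 : ∀ y, g y ^ 2 = 1 := fun y => by
    rw [hg]; simp only; rw [mul_pow, signOf_sq, twist_sq, one_mul]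
  have hfsum : fsum f g = fsum (fun x => signOf (a x)) (fun y => signOf (b y)) := by
    rw [fsum, fsum]
    rw [← Equiv.sum_comp (bxorPerm x₀) (fun x => ∑ y, signOf (a x) * twist x y * signOf (b y))]
    refine sum_congr rfl fun x _ => sum_congr rfl fun y _ => ?_
    rw [hf, hg, bxorPerm_apply]
    simp only
    rw [twist_bxor_left]
    ring
  have hS : fsum f g ^ 2 = (8 : ℝ) ^ n := by
    rw [hfsum]
    refine fsum_signOf_sq_of_forrelation_sq a b ?_
    rcases hΦ with h | h <;> rw [h] <;> norm_num
  obtain ⟨hpp, hcardp⟩ := perp_perp_eq_of_sq h0 hadd hcard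
  obtain ⟨hU0, hUadd⟩ := bxor_mem_perp V
  obtain ⟨r, hr⟩ := exists_twist_sum_ne_zero (U := univ.filter fun y => ∀ v ∈ V, twist v y = 1)
    ⟨_, hU0⟩ f hf1
  refine ⟨r, ?_⟩
  have key := sign_transport f g hf1 hg1 hS hUadd r
  -- the orthogonal of `V^⊥` is `V`
  have hfilt : (univ.filter fun y => ∀ x ∈ (univ.filter fun y => ∀ v ∈ V, twist v y = 1),
      twist x (bxor r y) = 1) = univ.filter (fun y => bxor r y ∈ V) := by
    ext y
    simp only [mem_filter, mem_univ, true_and]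
    constructor
    · intro hy
      have : bxor r y ∈ univ.filter (fun z => ∀ x ∈ (univ.filter fun y => ∀ v ∈ V, twist v y = 1),
          twist x z = 1) := mem_filter.2 ⟨mem_univ _, fun x hx => hy x (mem_filter.1 hx).2⟩
      rwa [hpp] at this
    · intro hy
      have : bxor r y ∈ univ.filter (fun z => ∀ x ∈ (univ.filter fun y => ∀ v ∈ V, twist v y = 1),
          twist x z = 1) := by rwa [hpp]
      exact fun x hx => (mem_filter.1 this).2 x (mem_filter.2 ⟨mem_univ _, hx⟩)
  rw [hfilt] at key
  have hcos := coset_sum_of_affine_on_cosets hadd b hM r x₀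
  simp only at hcos
  have hgsum : ∑ y ∈ univ.filter (fun y => bxor r y ∈ V), g y =
      ∑ y ∈ univ.filter (fun y => bxor r y ∈ V), signOf (b y) * twist x₀ y := rfl
  have hVpos : (0 : ℝ) < V.card := by exact_mod_cast card_pos.2 ⟨_, h0⟩
  have hF : fsum f g = (2 : ℝ) ^ n * V.card ∨ fsum f g = -((2 : ℝ) ^ n * V.card) := by
    have h8 : ((2 : ℝ) ^ n * V.card) ^ 2 = (8 : ℝ) ^ n := by
      rw [mul_pow, hcard, ← pow_mul, ← pow_add, show n * 2 + n = 3 * n by ring, pow_mul]; norm_num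
    have : (fsum f g - (2 : ℝ) ^ n * V.card) * (fsum f g + (2 : ℝ) ^ n * V.card) = 0 := by
      nlinarith [hS, h8]
    rcases mul_eq_zero.1 this with h | h
    · left; linarith
    · right; linarith
  set Sa := ∑ x ∈ (univ.filter fun y => ∀ v ∈ V, twist v y = 1), twist x r * f x with hSa
  have hSa_val : Sa = V.card ∨ Sa = -V.card := by
    rw [hcardp, hgsum] at key
    have h2n : (0 : ℝ) < (2 : ℝ) ^ n * V.card := by positivity
    rcases hcos with hc | hc | hc <;> rcases hF with hFv | hFv <;> rw [hc, hFv] at key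
    · left; nlinarith [key, h2n]
    · right; nlinarith [key, h2n]
    · right; nlinarith [key, h2n]
    · left; nlinarith [key, h2n]
    · exfalso; apply hr
      have : ((2 : ℝ) ^ n * V.card) * Sa = 0 := by rw [hSa]; nlinarith [key]
      exact (mul_eq_zero.1 this).resolve_left h2n.ne'
    · exfalso; apply hr
      have : ((2 : ℝ) ^ n * V.card) * Sa = 0 := by rw [hSa]; nlinarith [key]
      exact (mul_eq_zero.1 this).resolve_left h2n.ne'
  have hterms : ∀ x ∈ (univ.filter fun y => ∀ v ∈ V, twist v y = 1),
      twist x r * f x = 1 ∨ twist x r * f x = -1 := by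
    intro x _
    simp only [hf]
    rcases twist_eq_one_or x r with h | h <;>
      rcases Bool.eq_false_or_eq_true (a (bxor x₀ x)) with h' | h' <;> simp [signOf, h, h']
  rcases hSa_val with h | h
  · have hall := all_eq_of_sum_eq_card _ (fun x => twist x r * f x) hterms 1 (Or.inl rfl)
      (by rw [one_mul, hcardp]; exact h)
    have hz := hall zeroVec hU0
    simp only [hf, twist_comm zeroVec, twist_zeroVec_right, one_mul, bxor_zeroVec] at hz
    intro x hx
    have := hall x hx
    simp only [hf] at this
    rw [mul_comm] at this
    rw [this, hz]
  · have hall := all_eq_of_sum_eq_card _ (fun x => twist x r * f x) hterms (-1) (Or.inr rfl)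
      (by rw [neg_one_mul, hcardp]; exact h)
    have hz := hall zeroVec hU0
    simp only [hf, twist_comm zeroVec, twist_zeroVec_right, one_mul, bxor_zeroVec] at hz
    intro x hx
    have := hall x hx
    simp only [hf] at this
    rw [mul_comm] at this
    rw [this, hz]

end DerivativeWalsh

end Literature.Computability.QuantumComplexity

end
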